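import Summits.PneNP.PneNP.Theorems.ChebyshevTracialDesignAllDirectionsReduction
import Summits.PneNP.PneNP.Theorems.ChebyshevTracialDesignGammaDirectionAverageDep
import HarnessLib

/-!
# Cell pnp-psdrank, route `ChebyshevTracialDesign`: (CG_1′) FOR `H`-SYMMETRIC MASKS IN ALL MATCHING-DEPENDENT DIRECTIONS, AVERAGED OVER ALL
# MATCHINGS — brick 145 (crux `TracialDecayExp20`, stmt-PneNP-19878)

Brick 145 (prover g29; MEMO-32 §3). The pair-containment statement (CG_1′) of MEMO-21 §3(c′) asks, for a mask `f : cuts → [0,1]`, that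
`Σ_M Σ_U W(U,M) f(U)·(Σ_p c_M(p) x_p x_{π_M p})²` be `e^{−aD}`-small for ALL matching-dependent direction fields `|c_M| ≤ 1`. Bricks 117–144 priced the
`H`-symmetric masks `f = ψ(|U∩H|)` (`|H| = n/2`) in the TYPE-CONSTANT directions; brick 145d reduced an arbitrary pair-symmetric direction to its type
average plus the diagonal excess, and priced the excess by the `r = 1` rung entrywise. Here the pieces are assembled:
* `abs_classAvg_le_one` (class averages of `[−1,1]`-valued functions), `typeAvg_eq_gammaForm` (a type-constant direction with values `(ν₀, ν₁, ν₂)` on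
  the three edge types IS `4·(γ′[p,πp∈H] + λ′([p,πp∈H] − [p,πp∉H]) + (λ′+κ′))` with `(γ′,λ′,κ′) = ((ν₂−2ν₁+ν₀)/4, (ν₁−ν₀)/4, ν₀/4) ∈ [−1,1]³`);
* **`allDirections_designValue_le`**: for some `a > 0` and all large even `n`, every balanced exact design of the crux's shape
  (`IsBalancedDesign n t (Tq n) (dq n) 20 C w`), every balanced block `2|H| = n`, every mask `0 ≤ ψ ≤ G` and EVERY pair-symmetric direction field
  `c : PM_n → [n] → [−1,1]`:
  `Σ_M Σ_U W(U,M)·ψ(|U∩H|)·(Σ_p c_M(p) x_p x_{π_M p})² ≤ 7·10⁶·G·n⁶·(e^{−a·dq n} + 2^{−⌊n/40⌋})`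
  (type-constant part: brick 145c at the `M`-dependent type averages, ×16; excess: brick 145d §2 with the `r = 1` rung `rectangleDecayExp_all_holds`, ×8).
READING: (CG_1′) holds for the whole `H`-symmetric mask class (balanced `H`), unconditionally, `M`-averaged, ASYMPTOTIC ONLY; by MEMO-22 §1 what is left of
(CG_1′) is the sign-incoherent fluctuation for NON-symmetric (spread) masks. Pair-symmetry of `c_M` is no restriction (the containment form symmetrises,
brick 101). WHAT THIS FILE DOES NOT DO: unbalanced blocks, non-`H`-symmetric masks, the CG_1 ⇒ crux-on-𝒜₁ transfer; nothing on `TracialDecayExp20` itself,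
psd rank of P_PM(K_n), or P vs NP. [cite: Rothvoss2017, §2 and Lemma 7 (PDF pp. 5–8)] [cite: KeevashLifshitz2023, Thm. 1.8] [cite: GriblingDelaatLaurent2019, §5]
Stature: support/instrument (kernel lane, no defs, axioms standard). Supports stmt-PneNP-19878.
-/

set_option linter.dupNamespace false -- `Summit.PneNP.PneNP.…`: summit = sub-problem (D-0017)

noncomputable section

namespace Summit.PneNP.PneNP.Theorems.ChebyshevTracialDesignAllDirections

open Finset Literature.Barriers.PneNP Literature.Combinatorics.Optimization
open Summit.PneNP.PneNP.Theorems.ChebyshevTracialDesignAllDirectionsReduction (containment_le_typeAvg_add_excess sum_excess_le)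
open Summit.PneNP.PneNP.Theorems.ChebyshevTracialDesignGammaDirectionAverageDep (gammaDirection_designValue_le_dep)
open Summit.PneNP.PneNP.Theorems.ChebyshevTracialDesignCrossingPlaneAverage (dq_Tq_facts)
open Summit.PneNP.PneNP.Theorems.ChebyshevTracialDesignUnconditionalRungs (rectangleDecayExp_all_holds)

variable {n : ℕ}

/-- A class average of a `[−1,1]`-valued function lies in `[−1,1]` (also for the empty class, where it is `0`). [folklore] -/
theorem abs_classAvg_le_one (S : Finset (Fin n)) (c : Fin n → ℝ) (hc : ∀ p, |c p| ≤ 1) :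
    |(∑ q ∈ S, c q) / (S.card : ℝ)| ≤ 1 := by
  rcases Nat.eq_zero_or_pos S.card with h0 | hpos
  · rw [h0]; simp
  · have hpos' : (0 : ℝ) < S.card := by exact_mod_cast hpos
    rw [abs_div, abs_of_pos hpos', div_le_one hpos']
    calc |∑ q ∈ S, c q| ≤ ∑ q ∈ S, |c q| := abs_sum_le_sum_abs _ _
      _ ≤ ∑ _q ∈ S, (1 : ℝ) := sum_le_sum fun q _ => hc q
      _ = _ := by rw [sum_const, nsmul_eq_mul, mul_one]

/-- A type-constant direction is `4×` a `(γ′, λ′, κ′)`-form of brick 143: with `ν₀, ν₁, ν₂` the values on `H̄H̄`, mixed, `HH` edges,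
`ν(τ p) = 4·(γ′[p,πp∈H] + λ′([p,πp∈H] − [p,πp∉H]) + (λ′+κ′))` for `(γ′,λ′,κ′) = ((ν₂−2ν₁+ν₀)/4, (ν₁−ν₀)/4, ν₀/4)`.
[cite: Rothvoss2017, §2 (PDF p. 5)] -/
theorem typeAvg_eq_gammaForm (M : PMatch n) (H : Finset (Fin n)) (ν : Fin 3 → ℝ) (τ : Fin n → Fin 3)
    (hτ : ∀ p, ((τ p : ℕ)) = (if p ∈ H then 1 else 0) + (if M.2.partner p ∈ H then 1 else 0)) (p : Fin n) :
    ν (τ p) = 4 * ((ν 2 - 2 * ν 1 + ν 0) / 4 * (if (p ∈ H ∧ M.2.partner p ∈ H) then (1 : ℝ) else 0) +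
      ((ν 1 - ν 0) / 4 * ((if (p ∈ H ∧ M.2.partner p ∈ H) then (1 : ℝ) else 0) -
        (if (p ∉ H ∧ M.2.partner p ∉ H) then (1 : ℝ) else 0)) + ((ν 1 - ν 0) / 4 + ν 0 / 4))) := by
  have h := hτ p
  by_cases h1 : p ∈ H <;> by_cases h2 : M.2.partner p ∈ H
  · have : τ p = 2 := Fin.ext (by rw [h]; simp [h1, h2])
    rw [this]; simp [h1, h2]; ring
  · have : τ p = 1 := Fin.ext (by rw [h]; simp [h1, h2])
    rw [this]; simp [h1, h2]; ring
  · have : τ p = 1 := Fin.ext (by rw [h]; simp [h1, h2])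
    rw [this]; simp [h1, h2]; ring
  · have : τ p = 0 := Fin.ext (by rw [h]; simp [h1, h2])
    rw [this]; simp [h1, h2]; ring

/-- **(CG_1′) FOR `H`-SYMMETRIC MASKS IN ALL DIRECTIONS, `M`-AVERAGED (brick 145).** For some `a > 0` and all large even `n`: for every balanced exact
design `(t, C, w)` of degree `dq n` on levels `≤ Tq n` with `Σ|w| ≤ 20`, every balanced block `2|H| = n`, every mask `0 ≤ ψ ≤ G` and every
pair-symmetric direction field `c : PM_n → [n] → [−1,1]`:
`Σ_M Σ_U W(U,M)·ψ(|U∩H|)·(Σ_p c_M(p)·x_p x_{π_M p})² ≤ 7·10⁶·G·n⁶·(e^{−a·dq n} + 2^{−⌊n/40⌋})`.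
[cite: Rothvoss2017, §2 and Lemma 7 (PDF pp. 5–8)] [cite: KeevashLifshitz2023, Thm. 1.8] [cite: GriblingDelaatLaurent2019, §5] -/
theorem allDirections_designValue_le :
    ∃ a : ℝ, 0 < a ∧ ∃ n₀ : ℕ, ∀ n : ℕ, n₀ ≤ n → Even n → ∀ {t : ℕ} {C : Finset ℕ} {w : ℕ → ℝ},
    IsBalancedDesign n t (Tq n) (dq n) 20 C w →
    ∀ (H : Finset (Fin n)), 2 * H.card = n →
    ∀ (ψ : ℤ → ℝ) {G : ℝ}, 0 ≤ G → (∀ x, 0 ≤ ψ x) → (∀ x, ψ x ≤ G) →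
    ∀ (c : PMatch n → Fin n → ℝ), (∀ M p, |c M p| ≤ 1) → (∀ M p, c M (M.2.partner p) = c M p) →
    ∑ M : PMatch n, ∑ U : OddSet n, levelWeight n t C w U M *
        (ψ ((U.1 ∩ H).card : ℤ) *
          (∑ p : Fin n, c M p * ((if p ∈ U.1 then (1 : ℝ) else 0) * (if M.2.partner p ∈ U.1 then (1 : ℝ) else 0))) ^ 2) ≤
      7 * 10 ^ 6 * G * (n : ℝ) ^ 6 * (Real.exp (-(a * dq n)) + (1 / 2 : ℝ) ^ (n / 40)) := by
  classical
  obtain ⟨a, ha, n₁, hrung⟩ := rectangleDecayExp_all_holds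
  obtain ⟨n₂, h145c⟩ := gammaDirection_designValue_le_dep ha
  refine ⟨a, ha, max (max n₁ n₂) 16, ?_⟩
  intro n hn hev t C w hdes H hH ψ G hG0 hψ0 hψG c hc hcπ
  have hn₁ : n₁ ≤ n := le_trans (le_trans (le_max_left _ _) (le_max_left _ _)) hn
  have hn₂ : n₂ ≤ n := le_trans (le_trans (le_max_right _ _) (le_max_left _ _)) hn
  have hn16 : 16 ≤ n := le_trans (le_max_right _ _) hn
  obtain ⟨h1, h2, h3, h4⟩ := dq_Tq_facts hn16
  have ht : Odd t := hdes.1.1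
  have hexp0 : 0 ≤ Real.exp (-(a * dq n)) + (1 / 2 : ℝ) ^ (n / 40) := by positivity
  -- the degenerate case `G = 0`
  rcases eq_or_lt_of_le hG0 with hG | hG
  · have hψ : ∀ x, ψ x = 0 := fun x => le_antisymm (by rw [hG]; exact hψG x) (hψ0 x)
    simp only [hψ, zero_mul, mul_zero, sum_const_zero, ← hG]
    positivity
  -- the type map and the type averages per matching
  have hτex : ∀ M : PMatch n, ∃ τ : Fin n → Fin 3, ∀ p, ((τ p : ℕ)) = (if p ∈ H then 1 else 0) + (if M.2.partner p ∈ H then 1 else 0) :=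
    fun M => ⟨fun p => ⟨(if p ∈ H then 1 else 0) + (if M.2.partner p ∈ H then 1 else 0), by split_ifs <;> omega⟩, fun p => rfl⟩
  choose τ hτ using hτex
  obtain ⟨ν, hν⟩ : ∃ ν : PMatch n → Fin 3 → ℝ, ∀ M k, ν M k =
      (∑ q ∈ univ.filter (fun q => τ M q = k), c M q) / ((univ.filter fun q => τ M q = k).card : ℝ) := ⟨_, fun _ _ => rfl⟩
  have hν1 : ∀ M k, |ν M k| ≤ 1 := fun M k => by rw [hν]; exact abs_classAvg_le_one _ (c M) (hc M)
  -- the per-matching reduction (brick 145d §1), with `v_M = ν_M ∘ τ_M`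
  have hred := fun M : PMatch n => containment_le_typeAvg_add_excess ht C w M H ψ (τ M) (hτ M) (c M) (hcπ M) (hc M)
    (fun p => ν M (τ M p)) (fun p => hν M (τ M p))
  -- the type-constant part in brick 143's `(γ′, λ′, κ′)`-form
  have hform : ∀ (M : PMatch n) (U : OddSet n),
      (∑ p : Fin n, ν M (τ M p) * ((if p ∈ U.1 then (1 : ℝ) else 0) * (if M.2.partner p ∈ U.1 then (1 : ℝ) else 0))) ^ 2 =
      16 * (∑ p : Fin n, ((ν M 2 - 2 * ν M 1 + ν M 0) / 4 * (if (p ∈ H ∧ M.2.partner p ∈ H) then (1 : ℝ) else 0) +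
        ((ν M 1 - ν M 0) / 4 * ((if (p ∈ H ∧ M.2.partner p ∈ H) then (1 : ℝ) else 0) -
          (if (p ∉ H ∧ M.2.partner p ∉ H) then (1 : ℝ) else 0)) + ((ν M 1 - ν M 0) / 4 + ν M 0 / 4))) *
        ((if p ∈ U.1 then (1 : ℝ) else 0) * (if M.2.partner p ∈ U.1 then (1 : ℝ) else 0))) ^ 2 := by
    intro M U
    rw [show (16 : ℝ) = 4 ^ 2 by norm_num, ← mul_pow, mul_sum]
    congr 1
    refine sum_congr rfl fun p _ => ?_
    rw [typeAvg_eq_gammaForm M H (ν M) (τ M) (hτ M) p]; ring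
  have hgam' : ∀ M, |(ν M 2 - 2 * ν M 1 + ν M 0) / 4| ≤ 1 := fun M => by
    have a0 := abs_le.1 (hν1 M 0); have a1 := abs_le.1 (hν1 M 1); have a2 := abs_le.1 (hν1 M 2)
    rw [abs_le]; constructor <;> linarith
  have hlam' : ∀ M, |(ν M 1 - ν M 0) / 4| ≤ 1 := fun M => by
    have a0 := abs_le.1 (hν1 M 0); have a1 := abs_le.1 (hν1 M 1)
    rw [abs_le]; constructor <;> linarith
  have hkap' : ∀ M, |ν M 0 / 4| ≤ 1 := fun M => by
    have a0 := abs_le.1 (hν1 M 0)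
    rw [abs_le]; constructor <;> linarith
  have hGabs : ∀ x ∈ Icc (0 : ℤ) ((t : ℕ) : ℤ), |ψ x| ≤ G := fun x _ => by rw [abs_of_nonneg (hψ0 x)]; exact hψG x
  have htc := h145c n hn₂ hdes.1 h3 hdes.2 h2 h1 h4 H hH ψ hG0 hGabs (fun x _ => hψ0 x)
    (fun M => (ν M 2 - 2 * ν M 1 + ν M 0) / 4) (fun M => (ν M 1 - ν M 0) / 4) (fun M => ν M 0 / 4) hgam' hlam' hkap'
  -- the excess (brick 145d §2 with the `r = 1` rung)
  have hexc := sum_excess_le (levelWeight n t C w) (hrung n hn₁ hev t C w hdes) H ψ hG hψ0 hψG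
  -- assemble
  have hsum := sum_le_sum fun M (_ : M ∈ (univ : Finset (PMatch n))) => hred M
  rw [sum_add_distrib, ← mul_sum] at hsum
  refine hsum.trans ?_
  have htc' : ∑ M : PMatch n, ∑ U : OddSet n, levelWeight n t C w U M * (ψ ((U.1 ∩ H).card : ℤ) *
      (∑ p : Fin n, ν M (τ M p) * ((if p ∈ U.1 then (1 : ℝ) else 0) * (if M.2.partner p ∈ U.1 then (1 : ℝ) else 0))) ^ 2) ≤
      16 * (2 * 10 ^ 4 * (1 + 20) * G * (n : ℝ) ^ 6 * (Real.exp (-(a * dq n)) + (1 / 2 : ℝ) ^ (n / 40))) := by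
    have hrw : ∀ M : PMatch n, ∑ U : OddSet n, levelWeight n t C w U M * (ψ ((U.1 ∩ H).card : ℤ) *
        (∑ p : Fin n, ν M (τ M p) * ((if p ∈ U.1 then (1 : ℝ) else 0) * (if M.2.partner p ∈ U.1 then (1 : ℝ) else 0))) ^ 2) =
        16 * ∑ U : OddSet n, levelWeight n t C w U M * (ψ ((U.1 ∩ H).card : ℤ) *
        (∑ p : Fin n, ((ν M 2 - 2 * ν M 1 + ν M 0) / 4 * (if (p ∈ H ∧ M.2.partner p ∈ H) then (1 : ℝ) else 0) +
          ((ν M 1 - ν M 0) / 4 * ((if (p ∈ H ∧ M.2.partner p ∈ H) then (1 : ℝ) else 0) -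
            (if (p ∉ H ∧ M.2.partner p ∉ H) then (1 : ℝ) else 0)) + ((ν M 1 - ν M 0) / 4 + ν M 0 / 4))) *
          ((if p ∈ U.1 then (1 : ℝ) else 0) * (if M.2.partner p ∈ U.1 then (1 : ℝ) else 0))) ^ 2) := by
      intro M
      rw [mul_sum]
      refine Fintype.sum_congr _ _ fun U => ?_
      rw [hform M U]; ring
    rw [Fintype.sum_congr _ _ hrw, ← mul_sum]
    have := htc
    linarith
  have hn0 : (0 : ℝ) ≤ (n : ℝ) ^ 6 := by positivity
  have he1 : Real.exp (-(a * dq n)) ≤ Real.exp (-(a * dq n)) + (1 / 2 : ℝ) ^ (n / 40) := by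
    have : (0 : ℝ) ≤ (1 / 2 : ℝ) ^ (n / 40) := by positivity
    linarith
  have hexc' : 8 * ∑ M : PMatch n, ∑ p : Fin n, ∑ q ∈ univ.filter (fun q => q ≠ p ∧ q ≠ M.2.partner p),
      max (∑ U : OddSet n, levelWeight n t C w U M * (ψ ((U.1 ∩ H).card : ℤ) *
          (((if p ∈ U.1 then (1 : ℝ) else 0) * (if M.2.partner p ∈ U.1 then (1 : ℝ) else 0)) *
            ((if p ∈ U.1 then (1 : ℝ) else 0) * (if M.2.partner p ∈ U.1 then (1 : ℝ) else 0)))) -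
        ∑ U : OddSet n, levelWeight n t C w U M * (ψ ((U.1 ∩ H).card : ℤ) *
          (((if p ∈ U.1 then (1 : ℝ) else 0) * (if M.2.partner p ∈ U.1 then (1 : ℝ) else 0)) *
            ((if q ∈ U.1 then (1 : ℝ) else 0) * (if M.2.partner q ∈ U.1 then (1 : ℝ) else 0))))) 0 ≤
      160 * G * (n : ℝ) ^ 6 * (Real.exp (-(a * dq n)) + (1 / 2 : ℝ) ^ (n / 40)) := by
    have h1 := mul_le_mul_of_nonneg_left hexc (by norm_num : (0 : ℝ) ≤ 8)
    have h2 : G * (n : ℝ) ^ 6 * (20 * Real.exp (-(a * (dq n : ℝ)))) ≤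
        G * (n : ℝ) ^ 6 * (20 * (Real.exp (-(a * dq n)) + (1 / 2 : ℝ) ^ (n / 40))) :=
      mul_le_mul_of_nonneg_left (by linarith) (by positivity)
    linarith
  have hG6 : 0 ≤ G * (n : ℝ) ^ 6 * (Real.exp (-(a * dq n)) + (1 / 2 : ℝ) ^ (n / 40)) := by positivity
  linarith [htc', hexc', hG6]

end Summit.PneNP.PneNP.Theorems.ChebyshevTracialDesignAllDirections

end
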